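/-
Copyright (c) 2026 the pub-hodgecm-mathlib formalisation cell (harness21).  Prover seat hodgecm-mathlib-K2E1-p11 (g6), Track B ∕ K2-LIT, h413 = `stmt-HodgeConjecture-24833`,
R90-TF section S8 «ContSpec-n½», the `hsrc` supplier estate, census `R90/S8/CENSUS-UnfoldingLetterFree.K2E1-p11-g6.md` f7bfa6fc755d5846 item (c) (S8 dealer R90-CS-plan (g3),
S8-R240 (2) ∕ S8-R246 ∕ S8-R250 «(b)–(e) continue»): THE GOOD INERT PLACE READING of the pure-tensor letter `hΩ` — at a non-split good place `v` where the base point is `1`, the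
★ inert Iwasawa bricks (R90-C10-p07) transported from `U(Φ₃)(L⁺_v) ≤ GL₃(L ⊗ L⁺_v)` to ★ p864965's `localPi v ≤ Π_{w∣v} GL₃(L_w)` currency: the local weight `χ₁,w(σ(Z)_w⁻¹)` off the unit
shell, `1` on it, together with ★ `hin_of_torusEntries`' torus-entry witness for that weight.
-/
import Summits.HodgeConjecture.HodgeConjecture.Theorems.K2E1ChiBadPlaceReadingU3              -- ★ p865059 (this seat): dictionary `snd_quadraticFiniteAdeleMap_apply_placesOver`, `conjAdele_snd_apply_placesOver`; brings ★ p864965, ★ p865012, ★ (3-iv-a) `heisZ_snd_apply_placesOver`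
import Summits.HodgeConjecture.HodgeConjecture.Theorems.K2E1BigCellIwasawaTorusEntryU3Witness  -- ★ (R90-C10-p07): `exists_antidiag`; brings ★ FILE 2 `exists_torusEntry_iwasawa_letters`, `exists_heis_of_corner`, ★ `mem_cmLocalIntegralLevel_iff_forall_v_le_one`
import Literature.NumberTheory.Automorphic.LocalUnitaryGroupCongr                            -- ★ `antidiagOne_eq_over` (Mok's literal `Φ_N` = `(StdForm.antidiagonal N).over L`)
import Literature.NumberTheory.Automorphic.UnitaryGroupNonsplitPlace                          -- ★ `PlacesOver.subsingleton_of_smul_eq` (one place above a non-split `v`)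
import HarnessLib

/-!
# K2·E1 ∕ R90·S8 — `K2E1ChiGoodInertReadingU3`: THE GOOD INERT PLACE READING OF `hΩ` — the local weight `ω_v = χ₁,w(σ(Z)_w⁻¹)·𝟙{Q_v>1} + 𝟙{Q_v=1}` at a non-split good place with
# base-point component `1`, its «on» reading for ★ p864965 `hΩ_of_localReadings`, and its torus-entry witness for ★ `hin_of_torusEntries` — the ★ inert Iwasawa bricks transported into `localPi`

Cell `pub/hodgecm-mathlib`, crux h413 = `stmt-HodgeConjecture-24833`, route of record `HCCMUnconditional`; R90-TF section S8 «ContSpec-n½», road R2-χ₃ ((V)∕(R)′ OF RECORD row `hsrc`, the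
pure-tensor letter `hΩ` and the token `hin` of ★ p864821 `hsrc_of_record_at_basePoint_of_core`).  THEOREMS ONLY (no `def`, no `instance`, no `notation`, no named-fact hypothesis, no
`sorry`; default heartbeats); lane `--supports stmt-HodgeConjecture-24833 --as helper` (count-neutral).  Closes no socket.

THE MATHEMATICS ([Rogawski1990] §4.5 p. 45, §1.10 p. 9; [Casselman1980] §3; [MoeglinWaldspurger1995] II.1.6; [PlatonovRapinchuk1994] §5.1).  Let `v` be a finite place of `L⁺`
unramified and NON-SPLIT in `L` (`w` the place above it), `v ∤ 2`, `δ` a `w`-unit, and let the base point have component `(b₁)_v = 1`.  By ★ p865012 the `w`-component of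
`U(x) = (ι(w₀)·u((0,Ψ^∞(x₀,x₁)), θ(0,x₂)))_f·b₁` is `w₀·u(X_w, Z_w) = (0 0 1; 0 1 −σX_w; 1 X_w Z_w)` with (★ dictionary) `X = Ψ_v(p₀,p₁)`, `Z = ι_v(p₂)δ − ι_v(½)Ψ_vσΨ_v`, `p = x|_v`
— i.e. `evalPlace v (U x)` is the image under `GL₃(∏_w L_w) ≅ ∏_w GL₃(L_w)` (★ `localGLPiEquiv`) of the product `w₀·n(p)` of the ★ brick elements `w₀` (★ `exists_antidiag`) and
`n(p) = u(X, Z)` (★ `exists_heis_of_corner`) of `U(Φ₃)(L⁺_v)` (§2).  The ★ brick HEAD `exists_torusEntry_iwasawa_letters` supplies a torus-entry function `α` (`= σ(Z)_w⁻¹` off the unit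
shell) with (α) `‖α(p)‖_w·Q_v(p) = 1` for `Q_v(p) > 1`, (c-off) `w₀·n(p) = b·k`, `b ∈ B`, `k ∈ K_v = U(Φ₃)(𝒪_v)`, `(b₀₀)_w = α(p)` for `Q_v(p) > 1`, (c-on) `w₀·n(p) ∈ K_v` for `Q_v(p) = 1`.
Transported (§1: `B ↦` upper triangular at every `w' ∣ v`; `K_v ↦ K_{w'}(1) = K_{w'}(|𝔫|_{w'})` since `v ∤ 𝔫`, via ★ `mem_cmLocalIntegralLevel_iff_forall_v_le_one`; membership in `localPi` via
★ `localGLPiEquiv_mem_localPi_iff` and ★ `antidiagOne_eq_over`), this is EXACTLY the «on» reading of ★ p864965 `hΩ_of_localReadings` at `v` with the weight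
**`ω_v(p) := χ₁,w(α(p))` if `Q_v(p) > 1`, `:= 1` if `Q_v(p) = 1`** (`Q_v ≥ 1` always): off the shell `β = b`, `t_w = α(p)` (one place above `v`: ★ `PlacesOver.subsingleton_of_smul_eq`), on
the shell `β = 1`, `t = 1`.  And by construction `ω_v` carries the torus-entry witness `∃ α, (α) ∧ (Q_v = 1 → ω_v = 1) ∧ (Q_v > 1 → ω_v = χ₁,w(α))` = the `hT v hv w hw` body of ★
`K2E1ChiLocalMeansOfShellU3Letters.hin_of_torusEntries` BYTE FOR BYTE — so ★ p864821's `hω1` (weight `1` on `𝒪_v³ ⊆ {Q_v = 1}`) and token `hin` follow at the inert good places.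
* §1 transport: `mem_local_of_mem_cmLocalForm`, `coe_localGLPiEquiv_apply`, `blockTriangular_localGLPiEquiv_of_mem_borelU`, `localGLPiEquiv_apply_mem_valuedCongruenceSubgroup_one`.
* §2 `coe_localGLPiEquiv_antidiag_mul_heis`, **`evalPlace_bigCell_eq_localGLPiEquiv_of_evalPlace_eq_one`** (the component IS `w₀·n(p)`).
* §3 HEAD **`exists_goodInert_weight`** — `∃ ω_v`, (i) the `hin_of_torusEntries` witness, (ii) `∀ x`, the «on» reading of ★ `hΩ_of_localReadings` at `v`, (iii) `ω_v = 1` on `{Q_v = 1}`.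
HONEST LABEL: HC_CM is proved only modulo the 7 printed citations (2 remaining named inputs: hLiu418 = `stmt-HodgeConjecture-24832`, h413 = `stmt-HodgeConjecture-24833`) until rung 0
closes; REL ≠ ★ ≠ BUILT; unconditional; asserts no named fact, closes no socket; after this file the inert-good-place part of `hΩ`∕`hω1`∕`hin` = ★ modulo {base point `= 1` off `S₀`,
`S₀ ⊇` ramified ∪ `{v ∣ 2}` ∪ `{δ non-unit}` ∪ supp `𝔫`}; the SPLIT places (d) and the `ξ.ψ` factor (e) remain; count-neutral.

## References
* [Rogawski1990] J. D. Rogawski, *Automorphic Representations of Unitary Groups in Three Variables*, Ann. of Math. Stud. 123 (1990), §1.10 p. 9, §4.5 p. 45.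
* [Casselman1980] W. Casselman, *The unramified principal series of p-adic groups I*, Compositio Math. 40 (1980), §3.
* [MoeglinWaldspurger1995] C. Mœglin, J.-L. Waldspurger, *Spectral Decomposition and Eisenstein Series* (1995), II.1.6.
* [PlatonovRapinchuk1994] V. Platonov, A. Rapinchuk, *Algebraic Groups and Number Theory* (1994), §5.1.
-/

set_option autoImplicit false
set_option linter.dupNamespace false  -- the mandated namespace repeats the summit's segment (`HodgeConjecture.HodgeConjecture`)

noncomputable section

open NumberField IsDedekindDomain Filter Set Function
open scoped NNReal
open Literature.NumberTheory.GaloisRepresentations Literature.NumberTheory.GaloisRepresentations.HeckeCharacter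
open Literature.NumberTheory.GaloisRepresentations.IsNonarchimedeanLocalField
open Literature.NumberTheory.Automorphic Literature.NumberTheory.Automorphic.UnitaryGroup AdelicGroupData
open Literature.NumberTheory.Automorphic.Arthur2013.Leaves.TECR
open Summit.HodgeConjecture.HodgeConjecture.Cruxes.H413.K2E1ChiMidBlockUnfoldingLetterFreeU3 (apply_diag_ne_zero_of_blockTriangular)
open Summit.HodgeConjecture.HodgeConjecture.Cruxes.H413.K2E1ChiFinReadingEntriesU3 (coe_evalPlace_finPart_weylLongU_mul_heisChart_mul_of_evalPlace_eq_one)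
open Summit.HodgeConjecture.HodgeConjecture.Cruxes.H413.K2E1ChiBadPlaceReadingU3 (snd_quadraticFiniteAdeleMap_apply_placesOver conjAdele_snd_apply_placesOver)
open Summit.HodgeConjecture.HodgeConjecture.Cruxes.H413.K2E1IntertwiningFiniteHeightDictionaryU3 (heisZ_snd_apply_placesOver)
open Summit.HodgeConjecture.HodgeConjecture.Cruxes.H413.K2E1BigCellIwasawaTorusEntryU3Letters (exists_torusEntry_iwasawa_letters exists_heis_of_corner)
open Summit.HodgeConjecture.HodgeConjecture.Cruxes.H413.K2E1BigCellIwasawaTorusEntryU3Witness (exists_antidiag)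

namespace Summit.HodgeConjecture.HodgeConjecture.Cruxes.H413.K2E1ChiGoodInertReadingU3

variable (L : Type) [Field L] [NumberField L] [IsCMField L] (hc : IsCMField.complexConj L * IsCMField.complexConj L = 1)
  {δ : L} (hcδ : IsCMField.complexConj L δ = -δ) (hδ : δ ≠ 0) {d : ↥(maximalRealSubfield L)} (hd : δ * δ = algebraMap ↥(maximalRealSubfield L) L d)
  (v : HeightOneSpectrum (𝓞 ↥(maximalRealSubfield L)))

/-! ## §1 Transport `U(Φ₃)(L⁺_v) ≤ GL₃(∏_{w∣v} L_w)` → `localPi v ≤ Π_{w∣v} GL₃(L_w)` -/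

/-- The ★ bricks' group `U(σ, Φ₃)(L⁺_v)` (Mok's literal form `cmLocalForm`) IS the factor `«local» v` of the restricted product at `J = (StdForm.antidiagonal 3).over L` (★ `antidiagOne_eq_over`).
[cite: PlatonovRapinchuk1994, §5.1] -/
theorem mem_local_of_mem_cmLocalForm {g : GL (Fin 3) (LocalRing L v)} (hg : g ∈ unitaryGroupOfForm (conjLocal L (IsCMField.complexConj L) v) (cmLocalForm L 3 v)) :
    g ∈ «local» L (IsCMField.complexConj L) 3 ((StdForm.antidiagonal 3).over L) v := by
  show g ∈ unitaryGroupOfForm (conjLocal L (IsCMField.complexConj L) v) ((adelicForm L 3 ((StdForm.antidiagonal 3).over L)).map (adeleToLocal L v))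
  rw [← antidiagOne_eq_over L 3]
  exact hg

omit [IsCMField L] in
/-- Entries of the `w`-component of `localGLPiEquiv g`: `((g)_w)_{ij} = (g_{ij})_w` (★ `GLn.coe_piEquiv_apply`, rfl). [folklore] -/
theorem coe_localGLPiEquiv_apply (g : GL (Fin 3) (LocalRing L v)) (w : PlacesOver L v) (i j : Fin 3) :
    ((localGLPiEquiv L 3 v g w : GL (Fin 3) (w.1.adicCompletion L)) : Matrix (Fin 3) (Fin 3) (w.1.adicCompletion L)) i j = (g : Matrix (Fin 3) (Fin 3) (LocalRing L v)) i j w := rfl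

/-- **`B ↦` upper triangular at every `w ∣ v`**: the components of an element of the bricks' Borel `borelU` are upper triangular (★ `mem_borelU_iff`, entrywise). [cite: Rogawski1990, §1.10 p. 9] -/
theorem blockTriangular_localGLPiEquiv_of_mem_borelU {b : ↥(unitaryGroupOfForm (conjLocal L (IsCMField.complexConj L) v) (cmLocalForm L 3 v))}
    (hb : b ∈ borelU (conjLocal L (IsCMField.complexConj L) v) (cmLocalForm L 3 v)) (w : PlacesOver L v) :
    ((localGLPiEquiv L 3 v (b : GL (Fin 3) (LocalRing L v)) w : GL (Fin 3) (w.1.adicCompletion L)) : Matrix (Fin 3) (Fin 3) (w.1.adicCompletion L)).BlockTriangular id := by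
  intro i j hij
  rw [coe_localGLPiEquiv_apply, (mem_borelU_iff b).1 hb hij]
  rfl

/-- **`K_v ↦ K_w(1)` at every `w ∣ v`**: the components of an element of the bricks' `K_v = U(Φ₃)(𝒪_v)` (★ `cmLocalIntegralLevel`: all entries of `k` and `k⁻¹` integral at every `w ∣ v`, ★
`mem_cmLocalIntegralLevel_iff_forall_v_le_one`) lie in the valued congruence subgroup of radius `1` (`g`, `g⁻¹` integral, `g ≡ 1` to radius `1` trivially). [cite: PlatonovRapinchuk1994, §5.1] -/
theorem localGLPiEquiv_apply_mem_valuedCongruenceSubgroup_one {k : ↥(unitaryGroupOfForm (conjLocal L (IsCMField.complexConj L) v) (cmLocalForm L 3 v))}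
    (hk : k ∈ cmLocalIntegralLevel L 3 (Matrix.of fun i j : Fin 3 => if i.val + j.val + 1 = 3 then (1 : L) else 0) v) (w : PlacesOver L v) :
    localGLPiEquiv L 3 v (k : GL (Fin 3) (LocalRing L v)) w ∈ valuedCongruenceSubgroup (Fin 3) (1 : WithZero (Multiplicative ℤ)) := by
  obtain ⟨h₁, h₂⟩ := (mem_cmLocalIntegralLevel_iff_forall_v_le_one L 3 v k).1 hk
  have hinv : ((localGLPiEquiv L 3 v (k : GL (Fin 3) (LocalRing L v)) w)⁻¹ : GL (Fin 3) (w.1.adicCompletion L)) =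
      localGLPiEquiv L 3 v (((k⁻¹ : ↥(unitaryGroupOfForm (conjLocal L (IsCMField.complexConj L) v) (cmLocalForm L 3 v))) : GL (Fin 3) (LocalRing L v))) w := by
    rw [Subgroup.coe_inv, map_inv, Pi.inv_apply]
  refine (mem_valuedCongruenceSubgroup_iff (m := Fin 3)).2 ⟨fun i j => ?_, fun i j => ?_, fun i j => ?_⟩
  · rw [coe_localGLPiEquiv_apply]; exact h₁ i j w
  · rw [hinv, coe_localGLPiEquiv_apply]; exact h₂ i j w
  · rw [Matrix.sub_apply, coe_localGLPiEquiv_apply]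
    refine (Valuation.map_sub _ _ _).trans (max_le (h₁ i j w) ?_)
    rw [Matrix.one_apply]
    split_ifs <;> simp

/-! ## §2 The component at a place where the base point is `1` IS the bricks' `w₀·n(p)` -/

omit [IsCMField L] in
/-- The components of the bricks' product `w₀·n` (`w₀` of matrix `Φ₃`, `n` of matrix `u(X, Z) = (1 X Z; 0 1 −σX; 0 0 1)` over `L ⊗ L⁺_v = ∏_{w∣v} L_w`): at `w ∣ v` it is `(0 0 1; 0 1 −σX_w; 1 X_w Z_w)`.
[cite: Rogawski1990, §1.10 p. 9] -/
theorem coe_localGLPiEquiv_antidiag_mul_heis {w₀ n : GL (Fin 3) (LocalRing L v)} {X S Z : LocalRing L v}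
    (hw₀ : w₀.val = !![(0 : LocalRing L v), 0, 1; 0, 1, 0; 1, 0, 0])
    (hn : n.val = !![1, X, Z; 0, 1, -S; 0, 0, 1]) (w : PlacesOver L v) :
    ((localGLPiEquiv L 3 v (w₀ * n) w : GL (Fin 3) (w.1.adicCompletion L)) : Matrix (Fin 3) (Fin 3) (w.1.adicCompletion L)) = !![0, 0, 1; 0, 1, -(S w); 1, X w, Z w] := by
  -- the product over `∏_{w∣v} L_w` first (★ `Matrix.mul_fin_three`), then entrywise evaluation at `w` (`rfl`)
  have hprod : (w₀ * n).val = !![0, 0, 1; 0, 1, -S; 1, X, Z] := by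
    rw [Units.val_mul, hw₀, hn, Matrix.mul_fin_three]
    simp only [zero_mul, one_mul, mul_zero, mul_one, zero_add, add_zero]
  ext i j
  rw [coe_localGLPiEquiv_apply, hprod]
  fin_cases i <;> fin_cases j <;> rfl

/-- **THE COMPONENT IS `w₀·n(p)`.**  At a place `v` of `L⁺` where the base point has component `1` (`((b₁)_v)_w = 1` for every `w ∣ v`), for any bricks' elements `w₀` of matrix `Φ₃` and `n` of
matrix `u(Ψ_v(p₀,p₁), ι_v(p₂)δ − ι_v(½)Ψ_vσΨ_v)`, `p = x|_v`: `evalPlace v (U x) = localGLPiEquiv (w₀·n)` in `localPi v` (★ p865012 `…_of_evalPlace_eq_one` ∘ ★ dictionary, entrywise).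
[cite: Rogawski1990, §1.10 p. 9] [cite: PlatonovRapinchuk1994, §5.1] -/
theorem evalPlace_bigCell_eq_localGLPiEquiv_of_evalPlace_eq_one (x : Fin 3 → FiniteAdeleRing (𝓞 ↥(maximalRealSubfield L)) ↥(maximalRealSubfield L))
    (b₁ : ↥(finAdelic (↥(maximalRealSubfield L)) L (IsCMField.complexConj L) 3 ((StdForm.antidiagonal 3).over L)))
    (hb₁ : ∀ w : PlacesOver L v, ((((evalPlace (↥(maximalRealSubfield L)) L (IsCMField.complexConj L) 3 ((StdForm.antidiagonal 3).over L) v b₁ : localPi L (IsCMField.complexConj L) 3 ((StdForm.antidiagonal 3).over L) v) : LocalGLPi L 3 v) w :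
      GL (Fin 3) (w.1.adicCompletion L)) : Matrix (Fin 3) (Fin 3) (w.1.adicCompletion L)) = 1)
    {w₀ n : ↥(unitaryGroupOfForm (conjLocal L (IsCMField.complexConj L) v) (cmLocalForm L 3 v))}
    (hw₀ : (w₀ : GL (Fin 3) (LocalRing L v)).val = !![(0 : LocalRing L v), 0, 1; 0, 1, 0; 1, 0, 0])
    (hn : (n : GL (Fin 3) (LocalRing L v)).val = !![1, quadraticLocalEquiv L v (IsCMField.complexConj L) hcδ hδ (x 0 v, x 1 v),
        toLocalRing L v (x 2 v) * algebraMap L (LocalRing L v) δ -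
          toLocalRing L v 2⁻¹ * (quadraticLocalEquiv L v (IsCMField.complexConj L) hcδ hδ (x 0 v, x 1 v) * conjLocal L (IsCMField.complexConj L) v (quadraticLocalEquiv L v (IsCMField.complexConj L) hcδ hδ (x 0 v, x 1 v)));
        0, 1, -conjLocal L (IsCMField.complexConj L) v (quadraticLocalEquiv L v (IsCMField.complexConj L) hcδ hδ (x 0 v, x 1 v)); 0, 0, 1]) :
    ((evalPlace (↥(maximalRealSubfield L)) L (IsCMField.complexConj L) 3 ((StdForm.antidiagonal 3).over L) v
        (finPart (↥(maximalRealSubfield L)) L (IsCMField.complexConj L) 3 ((StdForm.antidiagonal 3).over L)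
          ((quasiSplit (↥(maximalRealSubfield L)) L (IsCMField.complexConj L) 3).toAdelic (weylLongU ((IsCMField.complexConj L : L ≃ₐ[↥(maximalRealSubfield L)] L) : L →+* L) (rfl : (StdForm.antidiagonal 3).over L = (StdForm.antidiagonal 3).over L)) *
            ((heisChart hc (((((0 : InfiniteAdeleRing L)), quadraticFiniteAdeleMap ↥(maximalRealSubfield L) L δ (x 0, x 1)) : AdeleRing (𝓞 L) L),
              traceZeroLine ↥(maximalRealSubfield L) L (IsCMField.complexConj L) hcδ hδ ((0, x 2) : AdeleRing (𝓞 ↥(maximalRealSubfield L)) ↥(maximalRealSubfield L))) :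
                ↥(adelicUnipotent ↥(maximalRealSubfield L) L (IsCMField.complexConj L) 3)) : (quasiSplit (↥(maximalRealSubfield L)) L (IsCMField.complexConj L) 3).Adelic)) * b₁) :
        localPi L (IsCMField.complexConj L) 3 ((StdForm.antidiagonal 3).over L) v) : LocalGLPi L 3 v) =
      localGLPiEquiv L 3 v ((w₀ : GL (Fin 3) (LocalRing L v)) * (n : GL (Fin 3) (LocalRing L v))) := by
  funext w
  refine Units.ext ?_
  rw [coe_evalPlace_finPart_weylLongU_mul_heisChart_mul_of_evalPlace_eq_one L hc _ _ b₁ v w (hb₁ w), conjAdele_snd_apply_placesOver L hcδ hδ x v w,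
    snd_quadraticFiniteAdeleMap_apply_placesOver L hcδ hδ x v w, heisZ_snd_apply_placesOver L hcδ hδ (0 : InfiniteAdeleRing L) (x 0) (x 1) (x 2) v w,
    coe_localGLPiEquiv_antidiag_mul_heis L v hw₀ hn w]

/-! ## §3 HEAD: the good inert weight, its `hin` witness and its «on» reading -/

include hd in
/-- **HEAD — THE GOOD INERT PLACE READING OF `hΩ`.**  `v` a finite place of `L⁺`, UNRAMIFIED and NON-SPLIT in `L` (`c • w = w`), `|2|_v = 1`, `δ` a `w`-unit; a level `𝔫` prime to `v` (`|𝔫|_{w'} = 1`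
at every `w' ∣ v`); a base point with `((b₁)_v)_{w'} = 1`.  THEN there is a local weight `ω_v : (L⁺_v)³ → ℂ` — namely `ω_v(p) = χ₁,w(α(p))` off the unit shell (`Q_v(p) > 1`, `α = σ(Z)_w⁻¹`
the ★ bricks' torus entry) and `ω_v(p) = 1` on it — such that:
(i) `∃ α, (‖α(p)‖_w·Q_v(p) = 1 off the shell) ∧ (Q_v = 1 → ω_v = 1) ∧ (Q_v > 1 → ω_v = χ₁,w(α))` — the `hT v hv w hw` body of ★ `hin_of_torusEntries`, BYTE FOR BYTE;
(ii) for every `x ∈ (𝔸_{L⁺,f})³` the «ON» READING of ★ p864965 `hΩ_of_localReadings` at `v`: `evalPlace v (U x) = β·κ` with `β` upper triangular and `κ_{w'} ∈ K_{w'}(|𝔫|_{w'})` at every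
`w' ∣ v`, local units `t_{w'} = (β_{w'})₀₀`, and `ω_v(x|_v) = ∏_{w'∣v} χ₁,w'(t_{w'})` (off the shell: the bricks' `b·k` transported by §1–§2, `t_w = α`; on it: `β = 1`, `t = 1`);
(iii) `ω_v = 1` on `{Q_v = 1} ⊇ 𝒪_v³` (★ p864821's `hω1`).
[cite: Rogawski1990, §4.5 p. 45] [cite: Casselman1980, §3] [cite: MoeglinWaldspurger1995, II.1.6] [cite: PlatonovRapinchuk1994, §5.1] -/
theorem exists_goodInert_weight (χ₁ : HeckeCharacter L) (𝔫 : Ideal (𝓞 L)) (w : PlacesOver L v)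
    (hunr : Algebra.IsUnramifiedIn (𝓞 L) v.asIdeal) (hw : IsCMField.complexConj L • w.1 = w.1)
    (h2 : Valued.v (2 : v.adicCompletion ↥(maximalRealSubfield L)) = 1) (hδu : Valued.v (algebraMap L (LocalRing L v) δ w) = 1)
    (h𝔫 : ∀ w' : PlacesOver L v, idealRadius L w'.1 𝔫 = 1)
    (b₁ : ↥(finAdelic (↥(maximalRealSubfield L)) L (IsCMField.complexConj L) 3 ((StdForm.antidiagonal 3).over L)))
    (hb₁ : ∀ w' : PlacesOver L v, ((((evalPlace (↥(maximalRealSubfield L)) L (IsCMField.complexConj L) 3 ((StdForm.antidiagonal 3).over L) v b₁ : localPi L (IsCMField.complexConj L) 3 ((StdForm.antidiagonal 3).over L) v) : LocalGLPi L 3 v) w' :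
      GL (Fin 3) (w'.1.adicCompletion L)) : Matrix (Fin 3) (Fin 3) (w'.1.adicCompletion L)) = 1) :
    ∃ ωv : (Fin 3 → v.adicCompletion ↥(maximalRealSubfield L)) → ℂ,
      -- (i) the torus-entry witness of ★ `hin_of_torusEntries` (its `hT v hv w hw` body)
      (∃ α : (Fin 3 → v.adicCompletion ↥(maximalRealSubfield L)) → (w.1.adicCompletion L)ˣ,
        (∀ p : Fin 3 → v.adicCompletion ↥(maximalRealSubfield L), 1 < (∏ w' : PlacesOver L v, max 1 (max ((normAbs (w'.1.adicCompletion L) (quadraticLocalEquiv L v (IsCMField.complexConj L) hcδ hδ (p 0, p 1) w') : ℝ≥0) : ℝ)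
            ((normAbs (w'.1.adicCompletion L) ((toLocalRing L v (p 2) * algebraMap L (LocalRing L v) δ -
              toLocalRing L v 2⁻¹ * (quadraticLocalEquiv L v (IsCMField.complexConj L) hcδ hδ (p 0, p 1) *
                conjLocal L (IsCMField.complexConj L) v (quadraticLocalEquiv L v (IsCMField.complexConj L) hcδ hδ (p 0, p 1)))) w') : ℝ≥0) : ℝ))) →
          ((normAbs (w.1.adicCompletion L) (α p : w.1.adicCompletion L) : ℝ≥0) : ℝ) * (∏ w' : PlacesOver L v, max 1 (max ((normAbs (w'.1.adicCompletion L) (quadraticLocalEquiv L v (IsCMField.complexConj L) hcδ hδ (p 0, p 1) w') : ℝ≥0) : ℝ)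
            ((normAbs (w'.1.adicCompletion L) ((toLocalRing L v (p 2) * algebraMap L (LocalRing L v) δ -
              toLocalRing L v 2⁻¹ * (quadraticLocalEquiv L v (IsCMField.complexConj L) hcδ hδ (p 0, p 1) *
                conjLocal L (IsCMField.complexConj L) v (quadraticLocalEquiv L v (IsCMField.complexConj L) hcδ hδ (p 0, p 1)))) w') : ℝ≥0) : ℝ))) = 1) ∧
        (∀ p : Fin 3 → v.adicCompletion ↥(maximalRealSubfield L), (∏ w' : PlacesOver L v, max 1 (max ((normAbs (w'.1.adicCompletion L) (quadraticLocalEquiv L v (IsCMField.complexConj L) hcδ hδ (p 0, p 1) w') : ℝ≥0) : ℝ)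
            ((normAbs (w'.1.adicCompletion L) ((toLocalRing L v (p 2) * algebraMap L (LocalRing L v) δ -
              toLocalRing L v 2⁻¹ * (quadraticLocalEquiv L v (IsCMField.complexConj L) hcδ hδ (p 0, p 1) *
                conjLocal L (IsCMField.complexConj L) v (quadraticLocalEquiv L v (IsCMField.complexConj L) hcδ hδ (p 0, p 1)))) w') : ℝ≥0) : ℝ))) = 1 → ωv p = 1) ∧
        (∀ p : Fin 3 → v.adicCompletion ↥(maximalRealSubfield L), 1 < (∏ w' : PlacesOver L v, max 1 (max ((normAbs (w'.1.adicCompletion L) (quadraticLocalEquiv L v (IsCMField.complexConj L) hcδ hδ (p 0, p 1) w') : ℝ≥0) : ℝ)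
            ((normAbs (w'.1.adicCompletion L) ((toLocalRing L v (p 2) * algebraMap L (LocalRing L v) δ -
              toLocalRing L v 2⁻¹ * (quadraticLocalEquiv L v (IsCMField.complexConj L) hcδ hδ (p 0, p 1) *
                conjLocal L (IsCMField.complexConj L) v (quadraticLocalEquiv L v (IsCMField.complexConj L) hcδ hδ (p 0, p 1)))) w') : ℝ≥0) : ℝ))) →
          ωv p = ((χ₁.localComponent w.1 (α p) : ℂˣ) : ℂ))) ∧
      -- (ii) the «on» reading of ★ `hΩ_of_localReadings` at `v`, for every `x`
      (∀ x : Fin 3 → FiniteAdeleRing (𝓞 ↥(maximalRealSubfield L)) ↥(maximalRealSubfield L),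
        ∃ (β κ : localPi L (IsCMField.complexConj L) 3 ((StdForm.antidiagonal 3).over L) v) (t : ∀ w' : PlacesOver L v, (w'.1.adicCompletion L)ˣ),
          (∀ w' : PlacesOver L v, ((((β : localPi L (IsCMField.complexConj L) 3 ((StdForm.antidiagonal 3).over L) v) : LocalGLPi L 3 v) w' : GL (Fin 3) (w'.1.adicCompletion L)) :
            Matrix (Fin 3) (Fin 3) (w'.1.adicCompletion L)).BlockTriangular id) ∧
          (∀ w' : PlacesOver L v, ((κ : localPi L (IsCMField.complexConj L) 3 ((StdForm.antidiagonal 3).over L) v) : LocalGLPi L 3 v) w' ∈ valuedCongruenceSubgroup (Fin 3) (idealRadius L w'.1 𝔫)) ∧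
          evalPlace (↥(maximalRealSubfield L)) L (IsCMField.complexConj L) 3 ((StdForm.antidiagonal 3).over L) v
            (finPart (↥(maximalRealSubfield L)) L (IsCMField.complexConj L) 3 ((StdForm.antidiagonal 3).over L)
              ((quasiSplit (↥(maximalRealSubfield L)) L (IsCMField.complexConj L) 3).toAdelic (weylLongU ((IsCMField.complexConj L : L ≃ₐ[↥(maximalRealSubfield L)] L) : L →+* L) (rfl : (StdForm.antidiagonal 3).over L = (StdForm.antidiagonal 3).over L)) *
                ((heisChart hc (((((0 : InfiniteAdeleRing L)), quadraticFiniteAdeleMap ↥(maximalRealSubfield L) L δ (x 0, x 1)) : AdeleRing (𝓞 L) L),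
                  traceZeroLine ↥(maximalRealSubfield L) L (IsCMField.complexConj L) hcδ hδ ((0, x 2) : AdeleRing (𝓞 ↥(maximalRealSubfield L)) ↥(maximalRealSubfield L))) :
                    ↥(adelicUnipotent ↥(maximalRealSubfield L) L (IsCMField.complexConj L) 3)) : (quasiSplit (↥(maximalRealSubfield L)) L (IsCMField.complexConj L) 3).Adelic)) * b₁) = β * κ ∧
          (∀ w' : PlacesOver L v, ((t w' : (w'.1.adicCompletion L)ˣ) : w'.1.adicCompletion L) =
            ((((β : localPi L (IsCMField.complexConj L) 3 ((StdForm.antidiagonal 3).over L) v) : LocalGLPi L 3 v) w' : GL (Fin 3) (w'.1.adicCompletion L)) : Matrix (Fin 3) (Fin 3) (w'.1.adicCompletion L)) 0 0) ∧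
          ωv (fun i => x i v) = ∏ w' : PlacesOver L v, ((χ₁.localComponent w'.1 (t w') : ℂˣ) : ℂ)) ∧
      -- (iii) the weight is `1` on the unit shell (★ p864821's `hω1` on `𝒪_v³`)
      (∀ p : Fin 3 → v.adicCompletion ↥(maximalRealSubfield L), (∏ w' : PlacesOver L v, max 1 (max ((normAbs (w'.1.adicCompletion L) (quadraticLocalEquiv L v (IsCMField.complexConj L) hcδ hδ (p 0, p 1) w') : ℝ≥0) : ℝ)
            ((normAbs (w'.1.adicCompletion L) ((toLocalRing L v (p 2) * algebraMap L (LocalRing L v) δ -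
              toLocalRing L v 2⁻¹ * (quadraticLocalEquiv L v (IsCMField.complexConj L) hcδ hδ (p 0, p 1) *
                conjLocal L (IsCMField.complexConj L) v (quadraticLocalEquiv L v (IsCMField.complexConj L) hcδ hδ (p 0, p 1)))) w') : ℝ≥0) : ℝ))) = 1 → ωv p = 1) := by
  classical
  haveI : Algebra.IsQuadraticExtension ↥(maximalRealSubfield L) L := IsCMField.isQuadraticExtension L
  haveI : Subsingleton (PlacesOver L v) := PlacesOver.subsingleton_of_smul_eq (IsCMField.complexConj L) (IsCMField.complexConj_ne_one L) w hw
  -- the ★ bricks: `w₀` of matrix `Φ₃`, the torus entry `α` with (α), (c-off), (c-on)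
  obtain ⟨w₀, hw₀⟩ := exists_antidiag L v
  obtain ⟨α, hα, hoff, hon⟩ := exists_torusEntry_iwasawa_letters L hcδ hδ hd v w hunr hw h2 hδu hw₀
  -- the weight: `χ₁,w(α p)` off the unit shell, `1` on it
  refine ⟨fun p => if 1 < (∏ w' : PlacesOver L v, max 1 (max ((normAbs (w'.1.adicCompletion L) (quadraticLocalEquiv L v (IsCMField.complexConj L) hcδ hδ (p 0, p 1) w') : ℝ≥0) : ℝ)
            ((normAbs (w'.1.adicCompletion L) ((toLocalRing L v (p 2) * algebraMap L (LocalRing L v) δ -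
              toLocalRing L v 2⁻¹ * (quadraticLocalEquiv L v (IsCMField.complexConj L) hcδ hδ (p 0, p 1) *
                conjLocal L (IsCMField.complexConj L) v (quadraticLocalEquiv L v (IsCMField.complexConj L) hcδ hδ (p 0, p 1)))) w') : ℝ≥0) : ℝ)))
      then ((χ₁.localComponent w.1 (α p) : ℂˣ) : ℂ) else 1,
    ⟨α, hα, fun p hQ => if_neg (not_lt.2 hQ.le), fun p hQ => if_pos hQ⟩, fun x => ?_, fun p hQ => if_neg (not_lt.2 hQ.le)⟩
  -- (ii) the reading at `x`; base coordinates `p := x|_v`, the Heisenberg element `n(p)`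
  obtain ⟨n, hn⟩ := exists_heis_of_corner L hcδ v (quadraticLocalEquiv L v (IsCMField.complexConj L) hcδ hδ (x 0 v, x 1 v)) (x 2 v)
  have hU := evalPlace_bigCell_eq_localGLPiEquiv_of_evalPlace_eq_one L hc hcδ hδ v x b₁ hb₁ hw₀ hn
  -- the local height at `p` is `≥ 1`: on the shell or off it
  have hQ1 : (1 : ℝ) ≤ ∏ w' : PlacesOver L v, max 1 (max ((normAbs (w'.1.adicCompletion L) (quadraticLocalEquiv L v (IsCMField.complexConj L) hcδ hδ ((fun i => x i v) 0, (fun i => x i v) 1) w') : ℝ≥0) : ℝ)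
            ((normAbs (w'.1.adicCompletion L) ((toLocalRing L v ((fun i => x i v) 2) * algebraMap L (LocalRing L v) δ -
              toLocalRing L v 2⁻¹ * (quadraticLocalEquiv L v (IsCMField.complexConj L) hcδ hδ ((fun i => x i v) 0, (fun i => x i v) 1) *
                conjLocal L (IsCMField.complexConj L) v (quadraticLocalEquiv L v (IsCMField.complexConj L) hcδ hδ ((fun i => x i v) 0, (fun i => x i v) 1)))) w') : ℝ≥0) : ℝ)) := by
    exact (Finset.prod_const_one (s := (Finset.univ : Finset (PlacesOver L v))) (M := ℝ)).symm.le.trans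
      (Finset.prod_le_prod (fun _ _ => zero_le_one) fun _ _ => le_max_left _ _)
  rcases hQ1.eq_or_lt with hQ | hQ
  · -- ON THE SHELL: `w₀·n(p) ∈ K_v` ⇒ `β = 1`, `κ = U(x)_v`, `t = 1`, weight `1`
    have hK := hon (fun i => x i v) hQ.symm n hn
    refine ⟨1, _, fun _ => 1, fun w' => ?_, fun w' => ?_, (one_mul _).symm, fun w' => ?_, ?_⟩
    · rw [OneMemClass.coe_one, Pi.one_apply, Units.val_one]
      exact Matrix.blockTriangular_one
    · rw [hU, h𝔫 w']
      exact localGLPiEquiv_apply_mem_valuedCongruenceSubgroup_one L v hK w'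
    · rw [OneMemClass.coe_one, Pi.one_apply, Units.val_one, Units.val_one, Matrix.one_apply_eq]
    · show (if _ then _ else (1 : ℂ)) = _
      rw [if_neg (not_lt.2 hQ.symm.le)]
      exact (Finset.prod_eq_one fun w' _ => by rw [map_one, Units.val_one]).symm
  · -- OFF THE SHELL: the bricks' `w₀·n(p) = b·k`, transported; `t_w = α p`
    obtain ⟨b, k, hbB, hkK, hwn, hb00⟩ := hoff (fun i => x i v) hQ n hn
    have hbk : (w₀ : GL (Fin 3) (LocalRing L v)) * (n : GL (Fin 3) (LocalRing L v)) = (b : GL (Fin 3) (LocalRing L v)) * (k : GL (Fin 3) (LocalRing L v)) := by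
      rw [← Subgroup.coe_mul, hwn, Subgroup.coe_mul]
    -- the diagonal entries of the Borel factor are units at every `w' ∣ v`
    have hne : ∀ w' : PlacesOver L v, ((b : GL (Fin 3) (LocalRing L v)) : Matrix (Fin 3) (Fin 3) (LocalRing L v)) 0 0 w' ≠ 0 := fun w' => by
      rw [← coe_localGLPiEquiv_apply L v]
      exact apply_diag_ne_zero_of_blockTriangular (blockTriangular_localGLPiEquiv_of_mem_borelU L v hbB w') 0
    refine ⟨⟨localGLPiEquiv L 3 v (b : GL (Fin 3) (LocalRing L v)), (localGLPiEquiv_mem_localPi_iff L (IsCMField.complexConj L) 3 ((StdForm.antidiagonal 3).over L) v _).2 (mem_local_of_mem_cmLocalForm L v b.2)⟩,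
      ⟨localGLPiEquiv L 3 v (k : GL (Fin 3) (LocalRing L v)), (localGLPiEquiv_mem_localPi_iff L (IsCMField.complexConj L) 3 ((StdForm.antidiagonal 3).over L) v _).2 (mem_local_of_mem_cmLocalForm L v k.2)⟩,
      fun w' => Units.mk0 _ (hne w'), fun w' => blockTriangular_localGLPiEquiv_of_mem_borelU L v hbB w', fun w' => ?_, ?_, fun w' => ?_, ?_⟩
    · rw [h𝔫 w']
      exact localGLPiEquiv_apply_mem_valuedCongruenceSubgroup_one L v hkK w'
    · refine Subtype.ext ?_
      rw [Subgroup.coe_mul, hU, hbk, map_mul]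
    · show ((Units.mk0 _ (hne w') : (w'.1.adicCompletion L)ˣ) : w'.1.adicCompletion L) =
        ((localGLPiEquiv L 3 v (b : GL (Fin 3) (LocalRing L v)) w' : GL (Fin 3) (w'.1.adicCompletion L)) : Matrix (Fin 3) (Fin 3) (w'.1.adicCompletion L)) 0 0
      rw [Units.val_mk0, coe_localGLPiEquiv_apply]
    · show (if _ then _ else (1 : ℂ)) = _
      rw [if_pos hQ, Fintype.prod_subsingleton _ w,
        show (fun w' : PlacesOver L v => Units.mk0 _ (hne w')) w = α (fun i => x i v) from Units.ext (by rw [Units.val_mk0, hb00])]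

end Summit.HodgeConjecture.HodgeConjecture.Cruxes.H413.K2E1ChiGoodInertReadingU3

end
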